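/-
Copyright (c) 2026 the pub-hodgecm-mathlib formalisation cell (harness21).  Prover seat hodgecm-mathlib-K2Liu-p10 (g0), Track B «K2-LIT»,
#184♮ = hLiu418 = `stmt-HodgeConjecture-24832`; LEAD F0P6-plan (g12) deals 06:27:59Z «Hol-2» ∕ 06:48:17Z «Hol-1», SIGS-RoadI-v3 §Hol
row Hol-2b (K2E5-plan (g5)).  THEOREMS ONLY (no `def`, no `instance`, no named-fact hypothesis, no `sorry`).
-/
import Summits.HodgeConjecture.HodgeConjecture.Theorems.K2LiuHermitianTubeAction
import Mathlib.Analysis.Calculus.MeanValue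
import Mathlib.Analysis.Calculus.Deriv.Mul
import Mathlib.Analysis.Calculus.Deriv.Add
import Mathlib.Analysis.Calculus.FDeriv.RestrictScalars
import HarnessLib

/-!
# Crux `HLiu418`, Road I, organ Hol-2b (core, tube currency): RIGIDITY — a holomorphic family on `ℌ_n^σ` invariant under all
# hermitian translations is constant, and an automorphic `F` of scalar `K_∞`-type with some weight `k_s ≠ 0` descending to such a
# family VANISHES (`Hol.3(c)` of SIGS-RoadI-v3, archimedean half)

Cell `hodgecm-mathlib`, crux item hLiu418 = `stmt-HodgeConjecture-24832` (helper lane, count-neutral).  Sequel of ★ Hol-2a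
`K2LiuHolTranslationInvariantConst` ((H)(K)(C) on `ι → ℂ`) and of the Hol-1 dictionary ★ `K2LiuHermitianTubeCocycle` ∕ ★ `K2LiuHermitianTubeAction`
(the tube `ℌ_n` = ★ `hermUpperHalfSpace n`, the action ★ `SiegelUpperHalfSpace.moeb`, the automorphy matrix ★ `denom`, the group `{Pᴴ J P = J}`).

THE ARGUMENT (Shimura 1997 §5–6 ∕ Braun 1949; here in the by-value form fixed by LEAD 06:48:17Z (iii) and SIGS v3.5 §Hol (E1)(E2)):
§1 (H′) — (H) of Hol-2a generalised from coordinate-real translations to translations along any set `S` of a complex normed space `E`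
stable under real scalings and with `E = S + iS`: a `ℂ`-differentiable `φ` on an open convex `U` with `φ(z + b) = φ(z)` (`b ∈ S`) is
constant (`fderiv` kills `S`, hence `S + iS = E`, then the mean value theorem).  §2 the instance `E = (σ → Fin n → Fin n → ℂ)` (the
coordinates of `∏_σ M_n(ℂ)`, Pi-normed as in ★ `Paramodular.IsHolomorphicOnH2`), `S` = the placewise HERMITIAN translations (real form:
`v = Re v + i Im v` entrywise-transposed), `U = ℌ_n^σ` (open and convex by ★ H1-B).  §3 THE RIGIDITY THEOREM `eq_zero_of_hol_of_transl_invariant`: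
DATA a finite set of places `σ`, weights `k : σ → ℤ`, a parameter type `X` (the finite-adelic variable `h_f`), `F : X → (σ → M_{2n}(ℂ)) → ℂ`
(the form on `H_∞ = ∏_σ U(J)`), `f : X → (σ → M_n(ℂ)) → ℂ` (its descent); HYPOTHESES (E0) the DICTIONARY `f x (g·i1) = (∏_s det(denom g_s i1)^{k_s}) · F x g`
for `g ∈ ∏ U(J)` (this is the scalar `K_∞`-type; H1-E proves it for `f = f_F`), (E1) `f x` holomorphic on `ℌ^σ` in coordinates, (E2) `f x (Z + b) = f x Z`
for all placewise-hermitian `b` (all archimedean translations — this is what «all Fourier coefficients `a_β`, `β ≠ 0`, vanish» gives through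
★ Φ1 `eq_tsum_fourierCoeffDelta` + `fourierCoeffDelta_unipDelta_mul`: `F = W_0(F)` is left-`N_Δ(𝔸)`-invariant), (E4) ONE symmetry
`γ ∈ ∏ U(J)` with `F x (γ g) = F (τ x) g` (a rational element: `τ` = the shift of the finite variable by `γ_f⁻¹`) whose cocycle
`J_γ(Z) = ∏_s det(denom γ_s Z_s)^{k_s}` is NOT constant on `ℌ^σ`; CONCLUSION `F x g = 0` for all `x` and all `g ∈ ∏ U(J)`.
Proof: (E1)(E2)+§2 ⇒ `f x ≡ c(x)` on `ℌ^σ`; (E0)+(E4)+cocycle ★ `det_denom_mul` + transitivity ★ `exists_siegel_moeb_I_eq` ⇒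
`f x (γ·Z) = J_γ(Z) f (τ x) Z`, so `c(x) = J_γ(Z) c(τx) = J_γ(W) c(τx)` forces `c(τ x) = 0` and then `c(x) = 0`; finally (E0) and
`det(denom g i1) ≠ 0` give `F x g = 0`.  §4 a NONCONSTANT-COCYCLE WITNESS for the inversion `γ_s = J` (cocycle `∏ det(Z_s)^{k_s}`) as soon as
some `k_{s₀} ≠ 0` and `0 < n`: `Z = i·1` off `s₀`, `Z_{s₀} ∈ {i·1, 2i·1}`.
NO Whitehead lemma, NO weak approximation.  The adelic sentence Hol.3(c) («all `a_β = 0`, `β ≠ 0`, some `k_σ ≠ 0` ⇒ `F = 0`») is this theorem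
+ the frames (H1-C) + ★ Φ1; it is assembled in `K2LiuHolFourierRigidityOfResidue` once H1-C lands.
Sources: [Shimura1997, §§5–6], [KudlaRapoport2013, §7]; proofs: Mathlib calculus (`Convex.is_const_of_fderivWithin_eq_zero`).
HONEST LABEL.  Helper lemmas, count-neutral; `HC_CM` is proved only modulo the 7 printed citations (2 remaining named inputs:
hLiu418 = `stmt-HodgeConjecture-24832`, h413 = `stmt-HodgeConjecture-24833`) until rung 0 closes.
-/

set_option autoImplicit false
set_option linter.dupNamespace false -- the mandated namespace repeats `HodgeConjecture.HodgeConjecture`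

namespace Summit.HodgeConjecture.HodgeConjecture.Cruxes.HLiu418.K2LiuHolTubeRigidity

open Matrix Complex Set Filter
open scoped MatrixGroups ComplexOrder Topology BigOperators ComplexConjugate
open Literature.NumberTheory.ModularForms.SiegelUpperHalfSpace (num denom moeb num_def denom_def moeb_def moeb_mul
  denom_mul_eq moeb_mul_denom moeb_one)
open Literature.AlgebraicGeometry.ShimuraVarieties.KudlaRapoport2013.Sec11Sec12MainTheorem (hermUpperHalfSpace)
open K2LiuHermitianTubeCocycle K2LiuHermitianTubeAction

/-! ## 1. (H′): holomorphic + invariant under a real form of translations ⇒ constant -/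

section General

variable {E : Type*} [NormedAddCommGroup E] [NormedSpace ℂ E] [NormedSpace ℝ E] [IsScalarTower ℝ ℂ E]

/-- The derivative of a `ℂ`-differentiable `φ`, invariant under translations by a really-scaling-stable set `S`, kills `S`.
[cite: Shimura1997, §5] -/
theorem fderiv_apply_eq_zero_of_transl {S : Set E} (hS : ∀ b ∈ S, ∀ t : ℝ, (t : ℂ) • b ∈ S) {U : Set E} (hU : IsOpen U)
    {φ : E → ℂ} (hφ : DifferentiableOn ℂ φ U) (hinv : ∀ z ∈ U, ∀ b ∈ S, z + b ∈ U → φ (z + b) = φ z)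
    {z : E} (hz : z ∈ U) {b : E} (hb : b ∈ S) : fderiv ℂ φ z b = 0 := by
  -- the real path `t ↦ z + t • b` and the composite `g = φ ∘ path`
  have hpath : HasDerivAt (fun t : ℝ => z + (t : ℂ) • b) ((1 : ℂ) • b) 0 :=
    (Complex.ofRealCLM.hasDerivAt.smul_const b).const_add z
  rw [one_smul] at hpath
  have hφz : HasFDerivAt φ (fderiv ℂ φ z) z := (hφ.differentiableAt (hU.mem_nhds hz)).hasFDerivAt
  have hcomp : HasDerivAt (φ ∘ fun t : ℝ => z + (t : ℂ) • b) ((fderiv ℂ φ z).restrictScalars ℝ b) 0 :=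
    (hφz.restrictScalars ℝ).comp_hasDerivAt_of_eq (0 : ℝ) hpath (by simp)
  -- `g` is constant near `0`
  have hnear : ∀ᶠ t : ℝ in 𝓝 0, z + (t : ℂ) • b ∈ U := by
    have hc : Continuous fun t : ℝ => z + (t : ℂ) • b :=
      continuous_const.add (Complex.continuous_ofReal.smul continuous_const)
    have h0 : (fun t : ℝ => z + (t : ℂ) • b) 0 ∈ U := by simpa using hz
    exact hc.continuousAt.preimage_mem_nhds (hU.mem_nhds h0)
  have hconst : (φ ∘ fun t : ℝ => z + (t : ℂ) • b) =ᶠ[𝓝 0] fun _ => φ z := by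
    filter_upwards [hnear] with t ht
    exact hinv z hz _ (hS b hb t) ht
  have hzero : HasDerivAt (φ ∘ fun t : ℝ => z + (t : ℂ) • b) 0 0 :=
    (hasDerivAt_const (0 : ℝ) (φ z)).congr_of_eventuallyEq hconst
  have := hcomp.unique hzero
  simpa using this

/-- If moreover `E = S + iS`, the derivative VANISHES. [cite: Shimura1997, §5] -/
theorem fderiv_eq_zero_of_transl {S : Set E} (hS : ∀ b ∈ S, ∀ t : ℝ, (t : ℂ) • b ∈ S)
    (hspan : ∀ v : E, ∃ a ∈ S, ∃ b ∈ S, v = a + I • b) {U : Set E} (hU : IsOpen U)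
    {φ : E → ℂ} (hφ : DifferentiableOn ℂ φ U) (hinv : ∀ z ∈ U, ∀ b ∈ S, z + b ∈ U → φ (z + b) = φ z)
    {z : E} (hz : z ∈ U) : fderiv ℂ φ z = 0 := by
  refine ContinuousLinearMap.ext fun v => ?_
  obtain ⟨a, ha, b, hb, rfl⟩ := hspan v
  rw [map_add, map_smul, fderiv_apply_eq_zero_of_transl hS hU hφ hinv hz ha,
    fderiv_apply_eq_zero_of_transl hS hU hφ hinv hz hb, smul_zero, add_zero]
  rfl

/-- **(H′)**: a `ℂ`-differentiable function on an open convex set, invariant under translations by a real form `S` (`E = S + iS`,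
`ℝ·S ⊆ S`), is CONSTANT there. [cite: Shimura1997, §5] -/
theorem apply_eq_apply_of_transl {S : Set E} (hS : ∀ b ∈ S, ∀ t : ℝ, (t : ℂ) • b ∈ S)
    (hspan : ∀ v : E, ∃ a ∈ S, ∃ b ∈ S, v = a + I • b) {U : Set E} (hU : IsOpen U) (hUc : Convex ℝ U)
    {φ : E → ℂ} (hφ : DifferentiableOn ℂ φ U) (hinv : ∀ z ∈ U, ∀ b ∈ S, z + b ∈ U → φ (z + b) = φ z)
    {x y : E} (hx : x ∈ U) (hy : y ∈ U) : φ x = φ y :=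
  hUc.is_const_of_fderivWithin_eq_zero hφ
    (fun z hz => by rw [fderivWithin_of_isOpen hU hz]; exact fderiv_eq_zero_of_transl hS hspan hU hφ hinv hz) hx hy

end General

/-! ## 2. The instance: coordinates of `∏_σ M_n(ℂ)`, hermitian translations, the tube `ℌ_n^σ` -/

section Coordinates

variable {σ : Type*} {n : ℕ}

/-- Placewise-hermitian coordinate vectors are stable under real scalings. [folklore] -/
theorem herm_transl_smul_mem {b : σ → Fin n → Fin n → ℂ} (hb : ∀ s i j, conj (b s j i) = b s i j) (t : ℝ) :
    ∀ s i j, conj (((t : ℂ) • b) s j i) = ((t : ℂ) • b) s i j := by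
  intro s i j
  simp only [Pi.smul_apply, smul_eq_mul, map_mul, conj_ofReal, hb s i j]

/-- **`M_n(ℂ)^σ = Herm + i·Herm`** in coordinates: every `v` is `a + i b` with `a, b` placewise hermitian
(`a = (v + v^*)/2`, `b = (v − v^*)/(2i)` entrywise). [folklore] -/
theorem exists_herm_add_I_smul_herm (v : σ → Fin n → Fin n → ℂ) :
    ∃ a ∈ {b : σ → Fin n → Fin n → ℂ | ∀ s i j, conj (b s j i) = b s i j},
      ∃ b ∈ {b : σ → Fin n → Fin n → ℂ | ∀ s i j, conj (b s j i) = b s i j}, v = a + I • b := by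
  refine ⟨fun s i j => (v s i j + conj (v s j i)) / 2, ?_, fun s i j => (v s i j - conj (v s j i)) / (2 * I), ?_, ?_⟩
  · intro s i j
    simp only [map_div₀, map_add, conj_conj, map_ofNat, add_comm]
  · intro s i j
    simp only [map_div₀, map_sub, conj_conj, map_mul, map_ofNat, conj_I]
    field_simp
    ring
  · funext s i j
    simp only [Pi.add_apply, Pi.smul_apply, smul_eq_mul]
    field_simp
    ring

variable [Fintype σ]

/-- The tube `ℌ_n^σ` in coordinates is open. [cite: KudlaRapoport2013, §7 (p. 31)] -/
theorem isOpen_coordTube : IsOpen {z : σ → Fin n → Fin n → ℂ | ∀ s, Matrix.of (z s) ∈ hermUpperHalfSpace n} := by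
  have h : {z : σ → Fin n → Fin n → ℂ | ∀ s, Matrix.of (z s) ∈ hermUpperHalfSpace n} =
      ⋂ s, (fun z : σ → Fin n → Fin n → ℂ => z s) ⁻¹' (hermUpperHalfSpace n) := by
    ext z; simp only [mem_setOf_eq, mem_iInter, mem_preimage]; rfl
  rw [h]
  exact isOpen_iInter_of_finite fun s => (isOpen_hermUpperHalfSpace n).preimage (continuous_apply s)

omit [Fintype σ] in
/-- The tube `ℌ_n^σ` in coordinates is convex. [cite: KudlaRapoport2013, §7 (p. 31)] -/
theorem convex_coordTube : Convex ℝ {z : σ → Fin n → Fin n → ℂ | ∀ s, Matrix.of (z s) ∈ hermUpperHalfSpace n} := by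
  intro z hz w hw a b ha hb hab s
  exact convex_hermUpperHalfSpace n (hz s) (hw s) ha hb hab

omit [Fintype σ] in
/-- Hermitian translations preserve the tube: `Im(Z + b) = Im Z`. [cite: KudlaRapoport2013, §7 (p. 31)] -/
theorem im_add_of_conjTranspose_eq {l : Type*} (Z : Matrix l l ℂ) {b : Matrix l l ℂ} (hb : bᴴ = b) :
    (2 * I)⁻¹ • (Z + b - (Z + b)ᴴ) = (2 * I)⁻¹ • (Z - Zᴴ) := by
  rw [conjTranspose_add, hb, add_sub_add_right_eq_sub]

omit [Fintype σ] in
/-- `Z + b ∈ ℌ_n` for `Z ∈ ℌ_n`, `b` hermitian. [cite: KudlaRapoport2013, §7 (p. 31)] -/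
theorem add_mem_hermUpperHalfSpace {Z b : Matrix (Fin n) (Fin n) ℂ} (hZ : Z ∈ hermUpperHalfSpace n) (hb : bᴴ = b) :
    Z + b ∈ hermUpperHalfSpace n := by
  rw [mem_hermUpperHalfSpace_iff, im_add_of_conjTranspose_eq Z hb]
  exact hZ

omit [Fintype σ] in
/-- A coordinate vector `b` with `conj (b s j i) = b s i j` gives hermitian matrices `Matrix.of (b s)`. [folklore] -/
theorem conjTranspose_of_eq {b : σ → Fin n → Fin n → ℂ} (hb : ∀ s i j, conj (b s j i) = b s i j) (s : σ) :
    (Matrix.of (b s))ᴴ = Matrix.of (b s) := by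
  ext i j
  exact hb s i j

/-- **Constancy on `ℌ_n^σ`**: a function of `σ`-tuples of matrices, holomorphic on `ℌ_n^σ` in coordinates and invariant under all
placewise-hermitian translations, is constant on `ℌ_n^σ`. [cite: Shimura1997, §5] -/
theorem apply_eq_apply_of_hol_of_herm_transl (f : (σ → Matrix (Fin n) (Fin n) ℂ) → ℂ)
    (hhol : DifferentiableOn ℂ (fun z : σ → Fin n → Fin n → ℂ => f fun s => Matrix.of (z s))
      {z | ∀ s, Matrix.of (z s) ∈ hermUpperHalfSpace n})
    (htrans : ∀ Z b : σ → Matrix (Fin n) (Fin n) ℂ, (∀ s, Z s ∈ hermUpperHalfSpace n) → (∀ s, (b s)ᴴ = b s) →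
      f (Z + b) = f Z)
    {Z W : σ → Matrix (Fin n) (Fin n) ℂ} (hZ : ∀ s, Z s ∈ hermUpperHalfSpace n) (hW : ∀ s, W s ∈ hermUpperHalfSpace n) :
    f Z = f W := by
  have key := apply_eq_apply_of_transl (E := σ → Fin n → Fin n → ℂ)
    (S := {b : σ → Fin n → Fin n → ℂ | ∀ s i j, conj (b s j i) = b s i j})
    (fun b hb t => herm_transl_smul_mem hb t) exists_herm_add_I_smul_herm isOpen_coordTube convex_coordTube hhol
    (fun z hz b hb _ => htrans (fun s => Matrix.of (z s)) (fun s => Matrix.of (b s)) hz (conjTranspose_of_eq hb))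
    (x := fun s => Matrix.of.symm (Z s)) (y := fun s => Matrix.of.symm (W s)) hZ hW
  simpa using key

end Coordinates

/-! ## 3. The rigidity theorem -/

section Rigidity

variable {σ : Type*} [Fintype σ] {n : ℕ} {X : Type*}

/-- The cocycle relation for the descended function: from the dictionary (E0) and the twisted invariance (E4),
`f x (γ·Z) = J_γ(Z) · f (τ x) Z` on `ℌ^σ`, `J_γ(Z) = ∏_s det(denom γ_s Z_s)^{k_s}`. [cite: Shimura1997, §5] -/
theorem descended_cocycle (k : σ → ℤ) (F : X → (σ → Matrix (Fin n ⊕ Fin n) (Fin n ⊕ Fin n) ℂ) → ℂ)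
    (f : X → (σ → Matrix (Fin n) (Fin n) ℂ) → ℂ)
    (hE0 : ∀ x g, (∀ s, (g s)ᴴ * Matrix.J (Fin n) ℂ * g s = Matrix.J (Fin n) ℂ) →
      f x (fun s => moeb (g s) (I • 1)) = (∏ s, (denom (g s) (I • 1)).det ^ k s) * F x g)
    {γ : σ → Matrix (Fin n ⊕ Fin n) (Fin n ⊕ Fin n) ℂ} (hγU : ∀ s, (γ s)ᴴ * Matrix.J (Fin n) ℂ * γ s = Matrix.J (Fin n) ℂ)
    {τ : X → X} (hγ : ∀ x g, (∀ s, (g s)ᴴ * Matrix.J (Fin n) ℂ * g s = Matrix.J (Fin n) ℂ) →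
      F x (fun s => γ s * g s) = F (τ x) g)
    (x : X) {Z : σ → Matrix (Fin n) (Fin n) ℂ} (hZ : ∀ s, Z s ∈ hermUpperHalfSpace n) :
    f x (fun s => moeb (γ s) (Z s)) = (∏ s, (denom (γ s) (Z s)).det ^ k s) * f (τ x) Z := by
  choose g hgU hgP hgZ using fun s => exists_siegel_moeb_I_eq (hZ s)
  have hγg : ∀ s, (γ s * g s)ᴴ * Matrix.J (Fin n) ℂ * (γ s * g s) = Matrix.J (Fin n) ℂ := fun s => mul_mem_UJ (hγU s) (hgU s)
  have hZ' : Z = fun s => moeb (g s) (I • 1) := funext fun s => (hgZ s).symm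
  have h1 : (fun s => moeb (γ s) (Z s)) = fun s => moeb (γ s * g s) (I • 1) := by
    funext s; rw [← hgZ s, moeb_mul_of_posDef (hgU s) posDef_im_I_smul_one]
  have hdet : ∀ s, (denom (γ s * g s) (I • 1)).det = (denom (γ s) (Z s)).det * (denom (g s) (I • 1)).det := by
    intro s; rw [det_denom_mul_of_posDef (hgU s) posDef_im_I_smul_one, hgZ s]
  have h0' : f (τ x) Z = (∏ s, (denom (g s) (I • 1)).det ^ k s) * F (τ x) g := by
    rw [hZ']; exact hE0 (τ x) g hgU
  rw [h1, hE0 x _ hγg, hγ x g hgU, h0']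
  simp only [hdet, mul_zpow, Finset.prod_mul_distrib, mul_assoc]

/-- **RIGIDITY (Hol.3(c), archimedean half).**  Let `F : X → ∏_σ M_{2n}(ℂ) → ℂ` and `f : X → ∏_σ M_n(ℂ) → ℂ` satisfy the dictionary
(E0) `f x (g·i1) = (∏_s det(denom g_s i1)^{k_s}) F x g` on `∏ U(J)`, (E1) each `f x` holomorphic on `ℌ_n^σ` (coordinates), (E2) each `f x`
invariant under all placewise-hermitian translations, and (E4) a symmetry `γ ∈ ∏ U(J)`, `F x (γ g) = F (τ x) g`, with NONCONSTANT cocycle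
`∏_s det(denom γ_s ·)^{k_s}` on `ℌ^σ`.  Then `F x g = 0` for every `x` and every `g ∈ ∏ U(J)`. [cite: Shimura1997, §§5–6] -/
theorem eq_zero_of_hol_of_transl_invariant (k : σ → ℤ) (F : X → (σ → Matrix (Fin n ⊕ Fin n) (Fin n ⊕ Fin n) ℂ) → ℂ)
    (f : X → (σ → Matrix (Fin n) (Fin n) ℂ) → ℂ)
    (hE0 : ∀ x g, (∀ s, (g s)ᴴ * Matrix.J (Fin n) ℂ * g s = Matrix.J (Fin n) ℂ) →
      f x (fun s => moeb (g s) (I • 1)) = (∏ s, (denom (g s) (I • 1)).det ^ k s) * F x g)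
    (hhol : ∀ x, DifferentiableOn ℂ (fun z : σ → Fin n → Fin n → ℂ => f x fun s => Matrix.of (z s))
      {z | ∀ s, Matrix.of (z s) ∈ hermUpperHalfSpace n})
    (htrans : ∀ x, ∀ Z b : σ → Matrix (Fin n) (Fin n) ℂ, (∀ s, Z s ∈ hermUpperHalfSpace n) → (∀ s, (b s)ᴴ = b s) →
      f x (Z + b) = f x Z)
    {γ : σ → Matrix (Fin n ⊕ Fin n) (Fin n ⊕ Fin n) ℂ} (hγU : ∀ s, (γ s)ᴴ * Matrix.J (Fin n) ℂ * γ s = Matrix.J (Fin n) ℂ)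
    {τ : X → X} (hγ : ∀ x g, (∀ s, (g s)ᴴ * Matrix.J (Fin n) ℂ * g s = Matrix.J (Fin n) ℂ) →
      F x (fun s => γ s * g s) = F (τ x) g)
    (hJ : ∃ Z W : σ → Matrix (Fin n) (Fin n) ℂ, (∀ s, Z s ∈ hermUpperHalfSpace n) ∧ (∀ s, W s ∈ hermUpperHalfSpace n) ∧
      (∏ s, (denom (γ s) (Z s)).det ^ k s) ≠ ∏ s, (denom (γ s) (W s)).det ^ k s)
    (x : X) {g : σ → Matrix (Fin n ⊕ Fin n) (Fin n ⊕ Fin n) ℂ}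
    (hg : ∀ s, (g s)ᴴ * Matrix.J (Fin n) ℂ * g s = Matrix.J (Fin n) ℂ) : F x g = 0 := by
  obtain ⟨Z, W, hZ, hW, hne⟩ := hJ
  -- every `f y` is constant on `ℌ^σ`
  have hconst : ∀ y, ∀ Z' W' : σ → Matrix (Fin n) (Fin n) ℂ, (∀ s, Z' s ∈ hermUpperHalfSpace n) →
      (∀ s, W' s ∈ hermUpperHalfSpace n) → f y Z' = f y W' :=
    fun y Z' W' hZ' hW' => apply_eq_apply_of_hol_of_herm_transl (f y) (hhol y) (htrans y) hZ' hW'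
  -- the constant `c(τ x)` vanishes: `c(x) = J(Z) c(τx) = J(W) c(τx)`
  have hγZ : ∀ s, moeb (γ s) (Z s) ∈ hermUpperHalfSpace n := fun s => moeb_mem_hermUpperHalfSpace (hγU s) (hZ s)
  have hγW : ∀ s, moeb (γ s) (W s) ∈ hermUpperHalfSpace n := fun s => moeb_mem_hermUpperHalfSpace (hγU s) (hW s)
  have h1 := descended_cocycle k F f hE0 hγU hγ x hZ
  have h2 := descended_cocycle k F f hE0 hγU hγ x hW
  have h12 : f x (fun s => moeb (γ s) (Z s)) = f x (fun s => moeb (γ s) (W s)) := hconst x _ _ hγZ hγW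
  have hfW : f (τ x) W = f (τ x) Z := hconst (τ x) _ _ hW hZ
  rw [h12, h2, hfW] at h1
  have hτ0 : f (τ x) Z = 0 := by
    by_contra h0
    exact hne (mul_right_cancel₀ h0 h1).symm
  -- hence `c(x) = 0`
  have hx0 : f x (fun s => moeb (γ s) (Z s)) = 0 := by
    rw [descended_cocycle k F f hE0 hγU hγ x hZ, hτ0, mul_zero]
  -- and `F x g = 0` by the dictionary at `g`
  have hgi : ∀ s, moeb (g s) (I • 1) ∈ hermUpperHalfSpace n :=
    fun s => moeb_mem_hermUpperHalfSpace (hg s) (I_smul_one_mem_hermUpperHalfSpace n)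
  have h3 := hE0 x g hg
  rw [hconst x _ _ hgi hγZ, hx0] at h3
  have hprod : (∏ s, (denom (g s) (I • 1)).det ^ k s) ≠ 0 :=
    Finset.prod_ne_zero_iff.2 fun s _ => zpow_ne_zero _ (det_denom_ne_zero (hg s) posDef_im_I_smul_one)
  exact (mul_eq_zero.1 h3.symm).resolve_left hprod

end Rigidity

/-! ## 4. A nonconstant-cocycle witness for the inversion -/

section Witness

variable {σ : Type*} [Fintype σ] [DecidableEq σ] {n : ℕ}

/-- `t i·1 ∈ ℌ_n` for real `t > 0`. [cite: KudlaRapoport2013, §7 (p. 31)] -/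
theorem real_smul_I_smul_one_mem {t : ℝ} (ht : 0 < t) : ((t : ℂ) * I) • (1 : Matrix (Fin n) (Fin n) ℂ) ∈ hermUpperHalfSpace n := by
  rw [mem_hermUpperHalfSpace_iff, conjTranspose_smul, conjTranspose_one, star_def, map_mul, conj_ofReal, conj_I, mul_neg,
    neg_smul, sub_neg_eq_add, ← two_smul ℂ, smul_smul, smul_smul, mul_assoc,
    show (2 * I)⁻¹ * (2 * ((t : ℂ) * I)) = (t : ℂ) by field_simp]
  exact PosDef.one.smul (zero_lt_real.2 ht)

/-- **For the inversion `γ_s = J` (cocycle `∏_s det(Z_s)^{k_s}`) the cocycle is NOT constant on `ℌ_n^σ`** as soon as `0 < n` and some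
`k_{s₀} ≠ 0`: compare `Z ≡ i·1` with `Z' = Z` off `s₀`, `Z'_{s₀} = 2i·1`. [cite: Shimura1997, §6.4] -/
theorem exists_det_zpow_prod_ne (hn : 0 < n) {k : σ → ℤ} {s₀ : σ} (hk : k s₀ ≠ 0) :
    ∃ Z W : σ → Matrix (Fin n) (Fin n) ℂ, (∀ s, Z s ∈ hermUpperHalfSpace n) ∧ (∀ s, W s ∈ hermUpperHalfSpace n) ∧
      (∏ s, (denom (Matrix.J (Fin n) ℂ) (Z s)).det ^ k s) ≠ ∏ s, (denom (Matrix.J (Fin n) ℂ) (W s)).det ^ k s := by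
  have h1 : (((1 : ℝ) : ℂ) * I) • (1 : Matrix (Fin n) (Fin n) ℂ) ∈ hermUpperHalfSpace n := real_smul_I_smul_one_mem one_pos
  have h2 : (((2 : ℝ) : ℂ) * I) • (1 : Matrix (Fin n) (Fin n) ℂ) ∈ hermUpperHalfSpace n := real_smul_I_smul_one_mem two_pos
  refine ⟨Function.update (fun _ => (((1 : ℝ) : ℂ) * I) • 1) s₀ ((((2 : ℝ) : ℂ) * I) • 1), fun _ => (((1 : ℝ) : ℂ) * I) • 1,
    fun s => ?_, fun _ => h1, fun heq => ?_⟩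
  · rcases eq_or_ne s s₀ with rfl | hs
    · rw [Function.update_self]; exact h2
    · rw [Function.update_of_ne hs]; exact h1
  simp only [denom_J] at heq
  rw [← Finset.mul_prod_erase Finset.univ _ (Finset.mem_univ s₀),
    ← Finset.mul_prod_erase Finset.univ (fun s => ((((1 : ℝ) : ℂ) * I) • (1 : Matrix (Fin n) (Fin n) ℂ)).det ^ k s)
      (Finset.mem_univ s₀), Function.update_self] at heq
  have hrest : ∏ s ∈ Finset.univ.erase s₀, (Function.update (fun _ => (((1 : ℝ) : ℂ) * I) • (1 : Matrix (Fin n) (Fin n) ℂ)) s₀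
      ((((2 : ℝ) : ℂ) * I) • 1) s).det ^ k s =
      ∏ s ∈ Finset.univ.erase s₀, ((((1 : ℝ) : ℂ) * I) • (1 : Matrix (Fin n) (Fin n) ℂ)).det ^ k s := by
    refine Finset.prod_congr rfl fun s hs => ?_
    rw [Function.update_of_ne (Finset.ne_of_mem_erase hs)]
  rw [hrest] at heq
  have hne0 : ∏ s ∈ Finset.univ.erase s₀, ((((1 : ℝ) : ℂ) * I) • (1 : Matrix (Fin n) (Fin n) ℂ)).det ^ k s ≠ 0 := by
    refine Finset.prod_ne_zero_iff.2 fun s _ => zpow_ne_zero _ ?_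
    rw [det_smul, det_one, mul_one]
    exact pow_ne_zero _ (mul_ne_zero (by norm_num) I_ne_zero)
  have hcancel := mul_right_cancel₀ hne0 heq
  rw [det_smul, det_smul, det_one, mul_one, mul_one, Fintype.card_fin, ofReal_one, one_mul] at hcancel
  -- take norms: `(2^n)^k = 1` with `2^n > 1`, `k ≠ 0`
  have hnorm := congrArg (fun z : ℂ => ‖z‖) hcancel
  simp only [norm_zpow, norm_pow, norm_mul, norm_I, mul_one, ofReal_ofNat, Complex.norm_ofNat, one_pow,
    _root_.one_zpow] at hnorm
  norm_cast at hnorm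
  have h2n : (1 : ℝ) < (2 : ℝ) ^ n := one_lt_pow₀ one_lt_two hn.ne'
  have hinj := zpow_right_injective₀ (by positivity : (0 : ℝ) < 2 ^ n) h2n.ne'
  have h' : ((2 : ℝ) ^ n) ^ k s₀ = ((2 : ℝ) ^ n) ^ (0 : ℤ) := by
    rw [zpow_zero]; exact_mod_cast hnorm
  exact hk (hinj h')

end Witness

end Summit.HodgeConjecture.HodgeConjecture.Cruxes.HLiu418.K2LiuHolTubeRigidity
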